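import Summits.ResolutionOfSingularities.ResolutionOfSingularities.Theorems.WeightedInvariantIotaOrder
import Summits.ResolutionOfSingularities.ResolutionOfSingularities.Theorems.WeightedInvariantOrderSemicontinuousSmooth
import Literature.AlgebraicGeometry.Resolution.RegularLocusPerfectField
import Literature.AlgebraicGeometry.Resolution.OrderGenericAlongPrime
import Literature.AlgebraicGeometry.Resolution.OrderAlongCurveGeneric
import Literature.AlgebraicGeometry.Resolution.OrderGenerizationCoheightOne
import Literature.AlgebraicGeometry.Resolution.CanonicalResolutionProofs
import Literature.AlgebraicGeometry.Resolution.QuasiExcellentLocalization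
import Mathlib.RingTheory.Localization.LocalizationLocalization
import HarnessLib

/-!
# Generic equimultiplicity of the order along a regular centre (door `HypersurfaceCentreConstruction`,
# stmt-ResolutionOfSingularities-19897 · ORDER (o23c) of res-L1-w43-plan-1, RULING gen 9 #4 (1), 2026-08-27T07:58:51Z)

Topic: `Summits/ResolutionOfSingularities/ResolutionOfSingularities/Theorems`. Helper for the door item
`HypersurfaceCentreConstruction` (stmt-ResolutionOfSingularities-19897, route `WeightedInvariant`): the one input that the
∀-model open presentation clause (open″) `JOpenPresentationForallSing` of the registered key H2a⁗-S needs at a NON-CLOSED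
position (REPORT FOR THE TYPING of `…LocalGameEFT4SDimOne.lean`, p511512): the exact signature recorded there,
«`∃ h ∉ 𝔭, ∀ 𝔮 ⊇ 𝔭 prime, h ∉ 𝔮 → iotaOrd (A_𝔮) F = iotaOrd (A_𝔭) F`» for `A` of finite type over a perfect field and
`A_𝔭` regular. [OURS · L1 W4.3] Replaces the role of NO printed item; NOT a statement of the manuscript
[claim: Hironaka2017, status: under-review]. AI work, weaker than expert review.

## What is proved (def-free, ring level — no schemes)

Let `k` be a perfect field, `A` a finitely generated `k`-algebra, `𝔭 ⊆ A` a prime with `A_𝔭` regular, `F ∈ A`.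

* `exists_not_mem_forall_isRegularLocalRing` — a basic open neighbourhood `D(h₀) ∋ 𝔭` inside the regular locus (the regular
  locus of `A` is open: tree `RegularLocusPerfectField.isOpen_regularLocus_of_perfectField`, Matsumura §30).
* `isRegularRing_away` — hence `A[h₀⁻¹]` is a regular ring (Mathlib `IsRegularRing`: its localisations at primes are the `A_𝔮`,
  `h₀ ∉ 𝔮`, through Mathlib's `localizationLocalizationAtPrimeIsoLocalization`).
* `mem_pow_maximalIdeal_iff_away` — for `h₀ ∉ 𝔮`: `F ∈ 𝔪_{A_𝔮}ⁿ ↔ F ∈ 𝔪_{A[h₀⁻¹]_{𝔮 A[h₀⁻¹]}ⁿ` (same local ring).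
* **`exists_not_mem_forall_mem_pow_and_not_mem_pow`** — if `F ∈ 𝔪_{A_𝔭}ⁿ ∖ 𝔪_{A_𝔭}ⁿ⁺¹` then there is `h ∉ 𝔭` with
  `F ∈ 𝔪_{A_𝔮}ⁿ ∖ 𝔪_{A_𝔮}ⁿ⁺¹` for every prime `𝔮 ⊇ 𝔭` with `h ∉ 𝔮`: the lower bound spreads trivially (`s F ∈ 𝔭ⁿ ⊆ 𝔮ⁿ`); the
  upper bound is the tree's ring-level generic bound `Resolution.exists_not_mem_forall_mul_not_mem_pow` (Cossart–Piltant 2008,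
  proof of Prop. 4.2: initial form with a unit coefficient) applied in the REGULAR ring `A[h₀⁻¹]`, whose J-2 input
  `Resolution.exists_not_mem_forall_isRegularLocalRing_quotient` comes from «finite type over a field ⇒ J-2»
  (`isJ2Ring_of_finiteType_field`, `isJ2Ring_of_isLocalization`), and pulled back to `A` along `𝔮 ↦ 𝔮 A[h₀⁻¹]`.
* **`exists_not_mem_forall_iotaOrd_eq`** — the `iotaOrd` form: for `F ≠ 0` in `A_𝔭` there is `h ∉ 𝔭` with
  `iotaOrd (A_𝔮) F = iotaOrd (A_𝔭) F` for all primes `𝔮 ⊇ 𝔭` with `h ∉ 𝔮` — GENERIC EQUIMULTIPLICITY of the order function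
  (o11) along the centre `V(𝔭)`, valid for `A_𝔭` regular of ANY dimension.

## References

* V. Cossart, O. Piltant, J. Algebra 320 (2008), proof of Prop. 4.2 (u.s.c. of the order / generic bound along a prime).
  [cite: CossartPiltant2008, Prop. 4.2 (proof)]
* H. Matsumura, *Commutative Ring Theory*, §30 Cor. to Thm. 30.5 (regular locus open), §32 p. 260 (J-2). [Matsumura1987]
-/

noncomputable section

open IsLocalRing Literature.AlgebraicGeometry.Resolution
open Summit.ResolutionOfSingularities.ResolutionOfSingularities.Cruxes.HypersurfaceCentreConstruction.LocalEngine

set_option linter.dupNamespace false -- mandated namespace of this single-conjunct summit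

namespace Summit.ResolutionOfSingularities.ResolutionOfSingularities.Theorems

namespace GenericEquimultiplicity

variable {A : Type} [CommRing A]

/-! ## A regular basic open neighbourhood, and the regular ring `A[h₀⁻¹]` -/

/-- **A basic open neighbourhood inside the regular locus** (`k` perfect, `A` of finite type, `A_𝔭` regular): there is
`h₀ ∉ 𝔭` with `A_𝔮` regular for every prime `𝔮 ∌ h₀` (the regular locus is open, Matsumura §30 Cor. to Thm. 30.5, and
the basic opens form a basis). [cite: Matsumura1987, §30 Cor. to Thm. 30.5] -/
theorem exists_not_mem_forall_isRegularLocalRing (k : Type) [Field k] [PerfectField k] [Algebra k A]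
    [Algebra.FiniteType k A] (𝔭 : Ideal A) [𝔭.IsPrime] (h𝔭 : IsRegularLocalRing (Localization.AtPrime 𝔭)) :
    ∃ h₀ ∉ 𝔭, ∀ (𝔮 : Ideal A) [𝔮.IsPrime], h₀ ∉ 𝔮 → IsRegularLocalRing (Localization.AtPrime 𝔮) := by
  have hopen : IsOpen (regularLocus A) := isOpen_regularLocus_of_perfectField k A
  have hmem : (⟨𝔭, inferInstance⟩ : PrimeSpectrum A) ∈ regularLocus A := h𝔭
  obtain ⟨_, ⟨h₀, rfl⟩, hmem₀, hsub⟩ :=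
    PrimeSpectrum.isTopologicalBasis_basic_opens.exists_subset_of_mem_open hmem hopen
  refine ⟨h₀, fun h => ?_, fun 𝔮 _ h𝔮 => ?_⟩
  · rw [SetLike.mem_coe, PrimeSpectrum.mem_basicOpen] at hmem₀
    exact hmem₀ h
  · have h𝔮mem : (⟨𝔮, inferInstance⟩ : PrimeSpectrum A) ∈ regularLocus A := by
      apply hsub
      rw [SetLike.mem_coe, PrimeSpectrum.mem_basicOpen]
      exact h𝔮
    exact h𝔮mem

/-- `h₀` lies in no prime of `A` pulled back from `A[h₀⁻¹]`. [folklore] -/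
theorem not_mem_comap_away {h₀ : A} (Q : Ideal (Localization.Away h₀)) [Q.IsPrime] :
    h₀ ∉ Q.comap (algebraMap A (Localization.Away h₀)) := by
  intro hmem
  rw [Ideal.mem_comap] at hmem
  exact (Ideal.IsPrime.ne_top inferInstance)
    (Q.eq_top_of_isUnit_mem hmem (IsLocalization.Away.algebraMap_isUnit h₀))

/-- **`A[h₀⁻¹]` is a regular ring** when every `A_𝔮`, `𝔮 ∌ h₀`, is regular (`A` Noetherian): its localisation at a prime `Q`
is `A_{Q ∩ A}` (Mathlib `localizationLocalizationAtPrimeIsoLocalization`). [folklore] -/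
theorem isRegularRing_away [IsNoetherianRing A] {h₀ : A}
    (hreg : ∀ (𝔮 : Ideal A) [𝔮.IsPrime], h₀ ∉ 𝔮 → IsRegularLocalRing (Localization.AtPrime 𝔮)) :
    IsRegularRing (Localization.Away h₀) := by
  haveI : IsNoetherianRing (Localization.Away h₀) :=
    IsLocalization.isNoetherianRing (Submonoid.powers h₀) _ inferInstance
  rw [isRegularRing_iff]
  intro Q _
  haveI : IsRegularLocalRing (Localization.AtPrime (Q.comap (algebraMap A (Localization.Away h₀)))) :=
    hreg _ (not_mem_comap_away Q)
  exact IsRegularLocalRing.of_ringEquiv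
    (IsLocalization.localizationLocalizationAtPrimeIsoLocalization (Submonoid.powers h₀) Q).toRingEquiv

/-! ## Primes of `A` off `V(h₀)` and primes of `A[h₀⁻¹]`; the same local rings -/

/-- `powers h₀` misses a prime not containing `h₀`. [folklore] -/
theorem disjoint_powers {h₀ : A} (𝔮 : Ideal A) [𝔮.IsPrime] (h𝔮 : h₀ ∉ 𝔮) :
    Disjoint (Submonoid.powers h₀ : Set A) (𝔮 : Set A) := by
  refine Set.disjoint_left.mpr ?_
  rintro x ⟨n, rfl⟩ hx
  exact h𝔮 (Ideal.IsPrime.mem_of_pow_mem inferInstance n hx)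

/-- The extension `𝔮 A[h₀⁻¹]` of a prime `𝔮 ∌ h₀` is prime. [folklore] -/
theorem isPrime_map_away {h₀ : A} (𝔮 : Ideal A) [𝔮.IsPrime] (h𝔮 : h₀ ∉ 𝔮) :
    (𝔮.map (algebraMap A (Localization.Away h₀))).IsPrime :=
  IsLocalization.isPrime_of_isPrime_disjoint (Submonoid.powers h₀) _ 𝔮 inferInstance (disjoint_powers 𝔮 h𝔮)

/-- `𝔮 A[h₀⁻¹] ∩ A = 𝔮` for a prime `𝔮 ∌ h₀`. [folklore] -/
theorem comap_map_away {h₀ : A} (𝔮 : Ideal A) [𝔮.IsPrime] (h𝔮 : h₀ ∉ 𝔮) :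
    (𝔮.map (algebraMap A (Localization.Away h₀))).comap (algebraMap A (Localization.Away h₀)) = 𝔮 :=
  IsLocalization.under_map_of_isPrime_disjoint (Submonoid.powers h₀) _ (inferInstance : 𝔮.IsPrime) (disjoint_powers 𝔮 h𝔮)

/-- An element of `A` maps into `𝔮 A[h₀⁻¹]` iff it lies in `𝔮` (`𝔮 ∌ h₀` prime). [folklore] -/
theorem algebraMap_mem_map_away_iff {h₀ : A} (𝔮 : Ideal A) [𝔮.IsPrime] (h𝔮 : h₀ ∉ 𝔮) (x : A) :
    algebraMap A (Localization.Away h₀) x ∈ 𝔮.map (algebraMap A (Localization.Away h₀)) ↔ x ∈ 𝔮 := by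
  rw [← Ideal.mem_comap, comap_map_away 𝔮 h𝔮]

/-- **The same local ring**: for a prime `𝔮 ∌ h₀`, `A_𝔮 ≃ A[h₀⁻¹]_{𝔮 A[h₀⁻¹]}` as `A`-algebras (Mathlib: the localisation of
`A[h₀⁻¹]` at a prime `Q` is the localisation of `A` at `Q ∩ A`; here `Q ∩ A = 𝔮`). [folklore] -/
theorem nonempty_algEquiv_away {h₀ : A} (𝔮 : Ideal A) [𝔮.IsPrime] (h𝔮 : h₀ ∉ 𝔮)
    [(𝔮.map (algebraMap A (Localization.Away h₀))).IsPrime] :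
    Nonempty (Localization.AtPrime 𝔮 ≃ₐ[A]
      Localization.AtPrime (𝔮.map (algebraMap A (Localization.Away h₀)))) := by
  have hinst := IsLocalization.isLocalization_atPrime_localization_atPrime (Submonoid.powers h₀)
    (𝔮.map (algebraMap A (Localization.Away h₀)))
  have hM : (Ideal.under A (𝔮.map (algebraMap A (Localization.Away h₀)))).primeCompl = 𝔮.primeCompl := by
    ext x
    change x ∉ Ideal.under A (𝔮.map (algebraMap A (Localization.Away h₀))) ↔ x ∉ 𝔮
    rw [Ideal.under_def, comap_map_away 𝔮 h𝔮]
  change IsLocalization _ _ at hinst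
  rw [hM] at hinst
  exact ⟨IsLocalization.algEquiv 𝔮.primeCompl (Localization.AtPrime 𝔮)
    (Localization.AtPrime (𝔮.map (algebraMap A (Localization.Away h₀))))⟩

/-- **Transport of `𝔪`-adic membership** between the two presentations of the local ring at `𝔮 ∌ h₀`:
`F ∈ 𝔪_{A_𝔮}ⁿ ↔ F ∈ 𝔪ⁿ` in `A[h₀⁻¹]_{𝔮 A[h₀⁻¹]}`. [folklore] -/
theorem mem_pow_maximalIdeal_iff_away {h₀ : A} (𝔮 : Ideal A) [𝔮.IsPrime] (h𝔮 : h₀ ∉ 𝔮)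
    [(𝔮.map (algebraMap A (Localization.Away h₀))).IsPrime] (x : A) (n : ℕ) :
    algebraMap A (Localization.AtPrime 𝔮) x ∈ maximalIdeal (Localization.AtPrime 𝔮) ^ n ↔
      algebraMap (Localization.Away h₀) (Localization.AtPrime (𝔮.map (algebraMap A (Localization.Away h₀))))
          (algebraMap A (Localization.Away h₀) x) ∈
        maximalIdeal (Localization.AtPrime (𝔮.map (algebraMap A (Localization.Away h₀)))) ^ n := by
  obtain ⟨e⟩ := nonempty_algEquiv_away 𝔮 h𝔮
  have he : e (algebraMap A (Localization.AtPrime 𝔮) x) =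
      algebraMap (Localization.Away h₀) (Localization.AtPrime (𝔮.map (algebraMap A (Localization.Away h₀))))
        (algebraMap A (Localization.Away h₀) x) := by
    rw [e.commutes, IsScalarTower.algebraMap_apply A (Localization.Away h₀)]
  rw [← he]
  change _ ↔ e.toRingEquiv (algebraMap A (Localization.AtPrime 𝔮) x) ∈ _
  rw [← map_ringEquiv_maximalIdeal e.toRingEquiv, ← Ideal.map_pow, Ideal.apply_mem_of_equiv_iff]

/-! ## The theorem -/

/-- **Generic equimultiplicity along a regular centre, membership form.** `k` perfect, `A` of finite type over `k`, `𝔭` a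
prime with `A_𝔭` regular, `F ∈ 𝔪_{A_𝔭}ⁿ ∖ 𝔪_{A_𝔭}ⁿ⁺¹`. Then there is `h ∉ 𝔭` such that `F ∈ 𝔪_{A_𝔮}ⁿ ∖ 𝔪_{A_𝔮}ⁿ⁺¹` for every
prime `𝔮 ⊇ 𝔭` with `h ∉ 𝔮`. Route (res-L1-w43-plan-1 RULING gen 9 #4 (1)): shrink into a regular basic open `D(h₀)`; in
the regular ring `A[h₀⁻¹]` (J-2, as of finite type over a field) apply the tree's ring-level generic bound along the prime
`𝔭 A[h₀⁻¹]` (Cossart–Piltant: initial form with a unit coefficient); read the bounds back in `A_𝔮 = A[h₀⁻¹]_{𝔮 A[h₀⁻¹]}`.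
[OURS · L1 W4.3 · (o23c)] [cite: CossartPiltant2008, Prop. 4.2 (proof)] -/
theorem exists_not_mem_forall_mem_pow_and_not_mem_pow (k : Type) [Field k] [PerfectField k] [Algebra k A]
    [Algebra.FiniteType k A] (𝔭 : Ideal A) [𝔭.IsPrime] (h𝔭 : IsRegularLocalRing (Localization.AtPrime 𝔭))
    {F : A} {n : ℕ} (hFn : algebraMap A (Localization.AtPrime 𝔭) F ∈ maximalIdeal (Localization.AtPrime 𝔭) ^ n)
    (hFn1 : algebraMap A (Localization.AtPrime 𝔭) F ∉ maximalIdeal (Localization.AtPrime 𝔭) ^ (n + 1)) :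
    ∃ h ∉ 𝔭, ∀ (𝔮 : Ideal A) [𝔮.IsPrime], 𝔭 ≤ 𝔮 → h ∉ 𝔮 →
      algebraMap A (Localization.AtPrime 𝔮) F ∈ maximalIdeal (Localization.AtPrime 𝔮) ^ n ∧
      algebraMap A (Localization.AtPrime 𝔮) F ∉ maximalIdeal (Localization.AtPrime 𝔮) ^ (n + 1) := by
  classical
  haveI : IsNoetherianRing A := Algebra.FiniteType.isNoetherianRing k A
  -- a regular basic open `D(h₀) ∋ 𝔭`
  obtain ⟨h₀, hh₀𝔭, hreg⟩ := exists_not_mem_forall_isRegularLocalRing k 𝔭 h𝔭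
  -- the regular J-2 ring `B = A[h₀⁻¹]` and the prime `P = 𝔭 B`
  haveI : IsRegularRing (Localization.Away h₀) := isRegularRing_away hreg
  have hJ2 : IsJ2Ring (Localization.Away h₀) :=
    isJ2Ring_of_isLocalization (Submonoid.powers h₀) (isJ2Ring_of_finiteType_field k A)
  haveI hP : (𝔭.map (algebraMap A (Localization.Away h₀))).IsPrime := isPrime_map_away 𝔭 hh₀𝔭
  -- the lower bound in `A`: `s₀ F ∈ 𝔭ⁿ`, `s₀ ∉ 𝔭`
  obtain ⟨s₀, hs₀, hs₀F⟩ :=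
    OrderSemicontinuity.exists_mul_mem_pow_of_algebraMap_mem_maximalIdeal_pow_general 𝔭
      (Localization.AtPrime 𝔭) hFn
  -- hypotheses of the ring-level generic bound, in `B` along `P`
  have hfm : ∃ s ∉ 𝔭.map (algebraMap A (Localization.Away h₀)),
      s * algebraMap A (Localization.Away h₀) F ∈ (𝔭.map (algebraMap A (Localization.Away h₀))) ^ n := by
    refine ⟨algebraMap A (Localization.Away h₀) s₀, ?_, ?_⟩
    · rw [algebraMap_mem_map_away_iff 𝔭 hh₀𝔭]
      exact hs₀
    · rw [← map_mul, ← Ideal.map_pow]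
      exact Ideal.mem_map_of_mem _ hs₀F
  have hfm1 : ∀ s ∉ 𝔭.map (algebraMap A (Localization.Away h₀)),
      s * algebraMap A (Localization.Away h₀) F ∉ (𝔭.map (algebraMap A (Localization.Away h₀))) ^ (n + 1) := by
    intro s hs hsF
    apply hFn1
    rw [mem_pow_maximalIdeal_iff_away 𝔭 hh₀𝔭]
    exact algebraMap_mem_maximalIdeal_pow_of_mul_mem_pow (𝔭.map (algebraMap A (Localization.Away h₀)))
      (Localization.AtPrime (𝔭.map (algebraMap A (Localization.Away h₀)))) hs hsF
  obtain ⟨g, hgP, hg⟩ := exists_not_mem_forall_mul_not_mem_pow (𝔭.map (algebraMap A (Localization.Away h₀)))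
    hfm hfm1 (exists_not_mem_forall_isRegularLocalRing_quotient hJ2 _)
  -- a numerator of `g` outside `𝔭`
  obtain ⟨⟨a, c⟩, hac⟩ := IsLocalization.surj (Submonoid.powers h₀) g
  have hcu : IsUnit (algebraMap A (Localization.Away h₀) (c : A)) := IsLocalization.map_units _ c
  have hga : ∀ (Q : Ideal (Localization.Away h₀)) [Q.IsPrime], algebraMap A (Localization.Away h₀) a ∈ Q → g ∈ Q := by
    intro Q _ haQ
    have h1 : g * algebraMap A (Localization.Away h₀) (c : A) ∈ Q := by rw [hac]; exact haQ
    rcases Ideal.IsPrime.mem_or_mem inferInstance h1 with h | h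
    · exact h
    · exact absurd (Q.eq_top_of_isUnit_mem h hcu) (Ideal.IsPrime.ne_top inferInstance)
  have ha𝔭 : a ∉ 𝔭 := fun ha =>
    hgP (hga _ ((algebraMap_mem_map_away_iff 𝔭 hh₀𝔭 a).mpr ha))
  -- the good element
  refine ⟨h₀ * a * s₀, fun hmem => ?_, fun 𝔮 _ h𝔭𝔮 hh𝔮 => ?_⟩
  · rcases Ideal.IsPrime.mem_or_mem inferInstance hmem with h | h
    · rcases Ideal.IsPrime.mem_or_mem inferInstance h with h' | h'
      · exact hh₀𝔭 h'
      · exact ha𝔭 h'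
    · exact hs₀ h
  · have hh₀𝔮 : h₀ ∉ 𝔮 := fun h => hh𝔮 (by
      rw [mul_assoc]; exact Ideal.mul_mem_right _ _ h)
    have ha𝔮 : a ∉ 𝔮 := fun h => hh𝔮 (by
      rw [mul_comm h₀ a, mul_assoc]; exact Ideal.mul_mem_right _ _ h)
    have hs₀𝔮 : s₀ ∉ 𝔮 := fun h => hh𝔮 (Ideal.mul_mem_left _ _ h)
    refine ⟨algebraMap_mem_maximalIdeal_pow_of_mul_mem_pow 𝔮 (Localization.AtPrime 𝔮) hs₀𝔮
      (Ideal.pow_right_mono h𝔭𝔮 n hs₀F), fun hF𝔮 => ?_⟩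
    -- read the upper bound in `B_{𝔮B} = A_𝔮`
    haveI hQ : (𝔮.map (algebraMap A (Localization.Away h₀))).IsPrime := isPrime_map_away 𝔮 hh₀𝔮
    have hPQ : 𝔭.map (algebraMap A (Localization.Away h₀)) ≤ 𝔮.map (algebraMap A (Localization.Away h₀)) :=
      Ideal.map_mono h𝔭𝔮
    have hgQ : g ∉ 𝔮.map (algebraMap A (Localization.Away h₀)) := fun hgmem =>
      ha𝔮 ((algebraMap_mem_map_away_iff 𝔮 hh₀𝔮 a).mp (by
        rw [← hac]; exact Ideal.mul_mem_right _ _ hgmem))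
    rw [mem_pow_maximalIdeal_iff_away 𝔮 hh₀𝔮] at hF𝔮
    obtain ⟨τ, hτ, hτF⟩ :=
      OrderSemicontinuity.exists_mul_mem_pow_of_algebraMap_mem_maximalIdeal_pow_general
        (𝔮.map (algebraMap A (Localization.Away h₀)))
        (Localization.AtPrime (𝔮.map (algebraMap A (Localization.Away h₀)))) hF𝔮
    exact hg _ hPQ hgQ τ hτ hτF

/-- **Generic equimultiplicity of the order function along a regular centre** (the exact signature requested by
res-L1-w43-plan-1 RULING gen 9 #4 (1) / p511512's REPORT): `k` perfect, `A` of finite type over `k`, `𝔭` a prime with `A_𝔭`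
regular (any dimension), `F ≠ 0` in `A_𝔭`. Then there is `h ∉ 𝔭` such that `iotaOrd (A_𝔮) F = iotaOrd (A_𝔭) F` for every prime
`𝔮 ⊇ 𝔭` with `h ∉ 𝔮`. [OURS · L1 W4.3 · (o23c)] [cite: CossartPiltant2008, Prop. 4.2 (proof)] -/
theorem exists_not_mem_forall_iotaOrd_eq (k : Type) [Field k] [PerfectField k] [Algebra k A]
    [Algebra.FiniteType k A] (𝔭 : Ideal A) [𝔭.IsPrime] (h𝔭 : IsRegularLocalRing (Localization.AtPrime 𝔭))
    (F : A) (hF0 : algebraMap A (Localization.AtPrime 𝔭) F ≠ 0) :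
    ∃ h ∉ 𝔭, ∀ (𝔮 : Ideal A) [𝔮.IsPrime], 𝔭 ≤ 𝔮 → h ∉ 𝔮 →
      iotaOrd (Localization.AtPrime 𝔮) (algebraMap A (Localization.AtPrime 𝔮) F) =
        iotaOrd (Localization.AtPrime 𝔭) (algebraMap A (Localization.AtPrime 𝔭) F) := by
  haveI := h𝔭
  obtain ⟨n, hn⟩ := Ordinal.lt_omega0.mp (iotaOrd_lt_omega0_of_ne_zero (Localization.AtPrime 𝔭) hF0)
  obtain ⟨hFn, hFn1⟩ := (iotaOrd_eq_natCast_iff (Localization.AtPrime 𝔭) _ n).mp hn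
  obtain ⟨h, hh𝔭, hh⟩ := exists_not_mem_forall_mem_pow_and_not_mem_pow k 𝔭 h𝔭 hFn hFn1
  refine ⟨h, hh𝔭, fun 𝔮 _ h𝔭𝔮 hh𝔮 => ?_⟩
  rw [hn]
  exact (iotaOrd_eq_natCast_iff (Localization.AtPrime 𝔮) _ n).mpr (hh 𝔮 h𝔭𝔮 hh𝔮)

end GenericEquimultiplicity

end Summit.ResolutionOfSingularities.ResolutionOfSingularities.Theorems

end
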